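import Summits.QuantumFields.BalabanUV.Beta.D1BFx.TorusGaugeBasis
import Summits.QuantumFields.BalabanUV.Beta.D1BFx.SortedEmbeddingWall
import Summits.QuantumFields.BalabanUV.Beta.D1BFx.StencilKernels
import Summits.QuantumFields.BalabanUV.Beta.ValueHessianBlind
import Summits.QuantumFields.BalabanUV.Beta.GAN24.RespStepBmDecompExact

/-!
# `BalabanUV.Beta.D1BFx.TorusGaugeBasisMatrix` — road «BF-x», binder row D1, slot (K), X₃(ii) ROUTE T, brick **K-TB3b «THE GAUGE BASIS FROM THE COMB
# ON THE TORUS»** PART 2 (owner SHAPE journal l.22310 §4; claim l.22580): the block-mean-free BASIS MATRIX `N̂` on the fine torus and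
# **`Ŵ₀ = ĝrad · N̂`** — the columns of PART 1's `What0 = (1 − Π̂)·τ_Tᵀ` ARE the fine-torus gradients of the periodised block-mean-free comb gauge
# functions `λ_b = bmGaugeAt ρ δ_b n` of the comb bonds `b`

CONTENT ([folklore] periodisation bookkeeping; in-block root `ρ = toSite r`, fine torus `Site (d+1) (n·p)`):
* §1 [our object] the lattice kernels `dzF` (gradient, rows = bonds, columns = sites) and `bmF r n` (`(w, (X,β)) ↦ λ_{(β,X)}(w)`), the torus matrices
  `gradHat s` (periodised `StencilKernels.dzKer`), `NhatF r n s` (all fine bonds) and **`Nhat r n p`** (comb columns, `Matrix (Site (d+1) (n·p)) (CombRows ρ n p)`).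
* §2 `bmGaugeAt_shift` (coarse-translation covariance of `bmGaugeAt`), `isPeriodic₂_bmF`, `rowBound_bmF` (finite support `ValueHessianBlind.bmGaugeAt_delta1_eq_zero`
  + the bound `GAN24.RespStepBmDecompExact.abs_bmGaugeAt_le_blockMass`), `compF_dzF_bmF : dzF ∘ bmF = δ − (Πᵀ)_ff` ON THE LATTICE (`grad λ_b = δ_b − Π_bm δ_b`,
  `BorderedHessianBlind.piKBm_inl_inl_eq`).
* §3 **`gradHat_mul_NhatF : ĝrad · N̂F = 1 − ((Πᵀ)_ff)^`** (fine torus), `PiHat_eq_submatrix` (PART 1's `Π̂` is the fine-torus `((Πᵀ)_ff)^` re-indexed by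
  `SortedEmbedding.e₁`), **`one_sub_PiHat_eq`**, `mul_tauT_transpose_apply`, **`What0_eq_grad_Nhat : What0 r n p = (gradHat (n·p)).submatrix (e₁ n p) id * Nhat r n p`**.
NOT HERE: the block-sum letter `Shat m s *ᵥ N̂_b = 0` in the `PeriodisedProjector` dialect (d = 3; follows from `AveragingPointsOfView.blockSum_bmGaugeAt`
— left to FILE 2 with the lattice statement `blockSum_bmF` below), `tauP`, `Amat`, the projector formula, the junction (FILE 2).

HONEST FRAMING (cell contract, verbatim): «discharging `BetaPertH` makes Bałaban's UV stability UNCONDITIONAL — a real constructive-QFT result; it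
is NOT the continuum limit and NOT the Clay problem.»  HONEST DEPENDENCY (verbatim): «continuum YM on T⁴ ⇐ BetaPertH ∧ nine spine estimates (0/9
proved); BetaPertH ⇐ (D1) ∧ (D4) ∧ CAP+tail; G-an2-4 gates asym, D1 and NE2/3/4.»  [folklore] bookkeeping BY NAME; no `Prop` is minted, nothing is
cited, no wall binder is instantiated; 0 sorry.  NOT D1, NOT BetaPertH.  ABSOLUTE RULE (cell, verbatim): «No internally-minted statement may enter as
a cited fact. Every hypothesis is either kernel-proved in this package or a verbatim quotation of a PUBLISHED theorem with page reference. The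
manuscript(s) under audit are NOT citable for their own disputed steps — they are the thing under adjudication; programme-internal
(2001/route/tribunal) claims are never citable.»  Provenance: D1 formalisation swarm, unit `b2b-balaban-beta-d1-formalise-leaf-03` (gen 8), 2026-08-20.
-/

noncomputable section

namespace Summit.QuantumFields.BalabanUV.Beta.D1BFx.TorusGaugeBasisMatrix

open Matrix
open Literature.Probability.LatticeModels (TorusSite Torus.proj)
open Literature.MathematicalPhysics.QuantumFieldTheory.LatticeForm (repZ quo)
open Literature.MathematicalPhysics.QuantumFieldTheory.Balaban1983to89
open Literature.MathematicalPhysics.QuantumFieldTheory.Balaban1983to89.Beta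
open ExpKernelCalculus (MKer Decays comp shiftK)
open AffineAveraging (box toSite unitVec blockSum)
open AveragingContours (blk grad shift blk_block)
open AveragingContoursRooted (treeGaugeAt)
open AxialProjector (blk_add_zsmul toSite_injective)
open AxialDressing (blockMass)
open KKTFluctuationKernel (delta1 delta1_apply)
open OneStepResolventKernel (Fib)
open Summit.QuantumFields.BalabanUV.Beta.TameKernelCalculus (Spr trK trK_apply)
open Summit.QuantumFields.BalabanUV.Beta.AxialProjectorBlockMean (blockMeanAt bmGaugeAt axProjBmAt)
open Summit.QuantumFields.BalabanUV.Beta.AxialDressingRooted (IsCombBondAt piKBm shiftK_piKBm spr_trK_piKBm treeGaugeAt_shift)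
open Summit.QuantumFields.BalabanUV.Beta.BorderedHessian (piKBm_inl_inl_eq bmGaugeAt_delta1_eq_zero)
open Summit.QuantumFields.BalabanUV.Beta.GAN24.RespStepBmDecompExact (abs_bmGaugeAt_le_blockMass)
open Summit.QuantumFields.BalabanUV.Beta.D1BFx.FibredPeriodisation
open Summit.QuantumFields.BalabanUV.Beta.D1BFx.SortedKernels
open Summit.QuantumFields.BalabanUV.Beta.D1BFx.SortedReblocking
open Summit.QuantumFields.BalabanUV.Beta.D1BFx.SortedPack
open Summit.QuantumFields.BalabanUV.Beta.D1BFx.SortedEmbedding (e₁ e₁_apply periodiseF_reblock_eq_submatrix)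
open Summit.QuantumFields.BalabanUV.Beta.D1BFx.SortedEmbeddingWall (isPeriodic₂_of_blockCov periodiseF_neg')
open Summit.QuantumFields.BalabanUV.Beta.D1BFx.PackedKernelSplit (blk_tt)
open Summit.QuantumFields.BalabanUV.Beta.D1BFx.PeriodicArrays (toF Kfib_toF)
open Summit.QuantumFields.BalabanUV.Beta.D1BFx.StencilKernels (dzKer isPeriodic₂_dzKer summable_dzKer_row)
open Summit.QuantumFields.BalabanUV.Beta.D1BFx.TorusCombKKT (I J CombRows tauT tauT_apply)
open Summit.QuantumFields.BalabanUV.Beta.D1BFx.TorusGaugeBasis (PiHat What0 shiftK_trK_piKBm)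
open scoped BigOperators

variable {d : ℕ} (r : Fin (d + 1) → ℕ) (n p : ℕ) [NeZero n] [NeZero p]

/-! ## §1 The lattice kernels and the torus matrices -/

/-- [our object] **THE LATTICE GRADIENT AS A FIBRED KERNEL**: rows = bonds `(x, α)`, columns = sites `(w, ⋆)`, entry `dzKer α x w = [w = x+e_α] − [w = x]`. -/
def dzF : FKer (d + 1) (Fin (d + 1)) Unit := fun i j => dzKer i.2 i.1 j.1

/-- [our object] **THE BLOCK-MEAN-FREE COMB GAUGE FUNCTIONS AS A FIBRED KERNEL**: rows = sites `(w, ⋆)`, columns = bonds `(X, β)`, entry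
`λ_{(β,X)}(w) = bmGaugeAt ρ δ_{(β,X)} n w` (`AxialProjectorBlockMean.bmGaugeAt`, in-block root `ρ = toSite r`). -/
def bmF : FKer (d + 1) Unit (Fin (d + 1)) := fun i j => bmGaugeAt (toSite r) (delta1 j.2 j.1) n i.1

/-- [our object] **THE REAL FINE-TORUS GRADIENT MATRIX** `ĝrad` (period `s`): rows = torus bonds, columns = torus sites; the periodised `dzKer`. -/
def gradHat (s : ℕ) [NeZero s] : Matrix (Beta.Site (d + 1) s × Fin (d + 1)) (Beta.Site (d + 1) s) ℝ :=
  Matrix.of fun i x => periodise₂ s (dzKer i.2) i.1 x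

/-- [our object] The periodised gauge functions of ALL fine bonds: `N̂F x (X̄, β) = Σ_images λ_{(β,X)}(x)`. -/
def NhatF (s : ℕ) [NeZero s] : Matrix (Beta.Site (d + 1) s) (Beta.Site (d + 1) s × Fin (d + 1)) ℝ :=
  Matrix.of fun x j => periodise₂ s (fun w X => bmGaugeAt (toSite r) (delta1 j.2 X) n w) x j.1

/-- [our object] **THE BASIS MATRIX `N̂`**: column `b` = the periodised block-mean-free comb gauge function of the comb bond `b` on the fine torus
`Site (d+1) (n·p)` (the comb bond read as a fine-torus bond through `SortedEmbedding.e₁`). -/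
def Nhat : Matrix (Beta.Site (d + 1) (n * p)) (CombRows (toSite r) n p) ℝ := fun x b => NhatF r n (n * p) x (e₁ n p b.1)

/-- [our object] `Nhat` through `NhatF`, by `rfl`. -/
theorem Nhat_apply (x : Beta.Site (d + 1) (n * p)) (b : CombRows (toSite r) n p) : Nhat r n p x b = NhatF r n (n * p) x (e₁ n p b.1) := rfl

section Bridge
variable (s : ℕ) [NeZero s]

/-- [our object] `ĝrad` is the fibred periodisation of `dzF` (trivial column fibre). -/
theorem gradHat_eq_submatrix :
    gradHat (d := d) s = (Matrix.of (periodiseF s (dzF (d := d)))).submatrix id (Equiv.prodPUnit _).symm := by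
  ext ⟨x, α⟩ w
  rfl

omit [NeZero n] in
/-- [our object] `N̂F` is the fibred periodisation of `bmF` (trivial row fibre). -/
theorem NhatF_eq_submatrix :
    NhatF r n s = (Matrix.of (periodiseF s (bmF r n))).submatrix (Equiv.prodPUnit _).symm id := by
  ext x ⟨X, β⟩
  rfl

omit [NeZero n] in
/-- [folklore] Hence `ĝrad · N̂F = (dzF)^ · (bmF)^` (the trivial fibre summed out). -/
theorem gradHat_mul_NhatF_eq :
    gradHat (d := d) s * NhatF r n s = Matrix.of (periodiseF s (dzF (d := d))) * Matrix.of (periodiseF s (bmF r n)) := by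
  ext i j
  rw [Matrix.mul_apply, Matrix.mul_apply, Fintype.sum_prod_type]
  refine Finset.sum_congr rfl fun x _ => ?_
  rw [Fintype.sum_unique]
  rfl

end Bridge

/-! ## §2 Covariance, periodicity, row bounds; the lattice identity `dzF ∘ bmF = δ − (Πᵀ)_ff` -/

/-- [folklore] **COARSE-TRANSLATION COVARIANCE OF `bmGaugeAt`**: `bmGaugeAt ρ A N (x + N•v) = bmGaugeAt ρ (shift (N•v) A) N x`
(`treeGaugeAt_shift` for the tree integral and for every point of the block mean). -/
theorem bmGaugeAt_shift {m : ℕ} (ρ : Fin (m) → ℤ) {N : ℕ} (hN : 1 ≤ N) (A : AffineAveraging.Form1 m ℝ) (x v : Fin m → ℤ) :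
    bmGaugeAt ρ A N (x + (N : ℤ) • v) = bmGaugeAt ρ (shift ((N : ℤ) • v) A) N x := by
  unfold bmGaugeAt blockMeanAt
  rw [Pi.sub_apply, Pi.sub_apply, treeGaugeAt_shift ρ hN A x v, blk_add_zsmul hN]
  congr 2
  unfold blockSum
  refine Finset.sum_congr rfl fun b _ => ?_
  rw [smul_add, show (N : ℤ) • blk N x + (N : ℤ) • v + toSite b = ((N : ℤ) • blk N x + toSite b) + (N : ℤ) • v by abel,
    treeGaugeAt_shift ρ hN A _ v]

/-- [folklore] The shifted indicator of a shifted bond is the indicator: `shift u δ_{(β, X+u)} = δ_{(β,X)}`. -/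
theorem shift_delta1 (u X : Fin (d + 1) → ℤ) (β : Fin (d + 1)) : shift u (delta1 β (X + u)) = delta1 β X := by
  funext κ x
  simp only [shift, delta1_apply, add_left_inj]

omit [NeZero p] in
/-- [folklore] The fibres of `bmF` are jointly `n·p`-periodic (block structure of period `n ∣ n·p`). -/
theorem isPeriodic₂_bmF (b : Unit) (β : Fin (d + 1)) : IsPeriodic₂ (n * p) (Kfib (bmF r n) b β) := by
  intro w X t
  rw [Kfib_apply, Kfib_apply]
  show bmGaugeAt (toSite r) (delta1 β (imageShift (n * p) X t)) n (imageShift (n * p) w t) = bmGaugeAt (toSite r) (delta1 β X) n w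
  rw [imageShift_mul_eq_add, imageShift_mul_eq_add, bmGaugeAt_shift _ (NeZero.one_le (n := n)), shift_delta1]

/-- [folklore] Rows of `dzF` are absolutely summable (two-point stencil). -/
theorem summable_abs_dzF (α : Fin (d + 1)) (b : Unit) (x : Fin (d + 1) → ℤ) : Summable fun y => |Kfib (dzF (d := d)) α b x y| :=
  (summable_dzKer_row α x).abs

omit [NeZero n] in
/-- [folklore] The block mass of a bond indicator is at most one. -/
theorem blockMass_delta1_le_one (β : Fin (d + 1)) (X c : Fin (d + 1) → ℤ) : blockMass n (delta1 β X) c ≤ 1 := by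
  unfold blockMass
  have h1 : ∀ b ∈ box (d + 1) n, ∑ κ : Fin (d + 1), |delta1 β X κ ((n : ℤ) • c + toSite b)|
      = if (n : ℤ) • c + toSite b = X then 1 else 0 := by
    intro b _
    by_cases h : (n : ℤ) • c + toSite b = X
    · rw [if_pos h, Finset.sum_eq_single β]
      · rw [delta1_apply, if_pos ⟨rfl, h⟩, abs_one]
      · intro κ _ hκ
        rw [delta1_apply, if_neg (fun hh => hκ hh.1), abs_zero]
      · intro hβ; exact absurd (Finset.mem_univ β) hβ
    · rw [if_neg h]
      exact Finset.sum_eq_zero fun κ _ => by rw [delta1_apply, if_neg (fun hh => h hh.2), abs_zero]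
  rw [Finset.sum_congr rfl h1, Finset.sum_boole]
  have hc : ((box (d + 1) n).filter fun b => (n : ℤ) • c + toSite b = X).card ≤ 1 :=
    Finset.card_le_one.2 fun b₁ hb₁ b₂ hb₂ => by
      rw [Finset.mem_filter] at hb₁ hb₂
      exact toSite_injective (add_left_cancel (hb₁.2.trans hb₂.2.symm))
  exact_mod_cast hc

/-- [folklore] **UNIFORM BOUND** `|λ_{(β,X)}(w)| ≤ 2(d+1)n`. -/
theorem abs_bmF_le (hr : r ∈ box (d + 1) n) (w X : Fin (d + 1) → ℤ) (β : Fin (d + 1)) :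
    |bmGaugeAt (toSite r) (delta1 β X) n w| ≤ 2 * (((d : ℝ) + 1) * n) := by
  have h := abs_bmGaugeAt_le_blockMass (NeZero.one_le (n := n)) hr (delta1 β X) w
  have hm := blockMass_delta1_le_one n β X (blk n w)
  have hpos : 0 ≤ ((d : ℝ) + 1) * n := by positivity
  nlinarith

/-- [folklore] **ROW BOUND FOR `bmF`**: for fixed `w`, `X ↦ λ_{(β,X)}(w)` is supported in the cube `|X_j − w_j| ≤ n` (`bmGaugeAt_delta1_eq_zero`), each
entry at most `2(d+1)n`. -/
theorem rowBound_bmF (hr : r ∈ box (d + 1) n) (b : Unit) (β : Fin (d + 1)) :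
    RowBound (Kfib (bmF r n) b β) (((2 * n + 1) ^ (d + 1) : ℕ) * (2 * (((d : ℝ) + 1) * n))) := by
  intro w
  set S : Finset (Fin (d + 1) → ℤ) := Fintype.piFinset fun j : Fin (d + 1) => Finset.Icc (w j - n) (w j + n) with hS
  have hzero : ∀ X ∉ S, Kfib (bmF r n) b β w X = 0 := by
    intro X hX
    rw [hS, Fintype.mem_piFinset] at hX
    obtain ⟨j, hj⟩ := not_forall.mp hX
    rw [Finset.mem_Icc, not_and_or, not_le, not_le] at hj
    rw [Kfib_apply]
    show bmGaugeAt (toSite r) (delta1 β X) n w = 0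
    apply bmGaugeAt_delta1_eq_zero (NeZero.one_le (n := n)) hr (j := j)
    rw [le_abs]
    rcases hj with h | h
    · left; linarith
    · right; linarith
  have hsum : Summable fun X => |Kfib (bmF r n) b β w X| :=
    summable_of_ne_finset_zero (s := S) fun X hX => by rw [hzero X hX, abs_zero]
  refine ⟨hsum, ?_⟩
  rw [tsum_eq_sum (s := S) fun X hX => by rw [hzero X hX, abs_zero]]
  have hcard : S.card = (2 * n + 1) ^ (d + 1) := by
    rw [hS, Fintype.card_piFinset, Finset.prod_congr rfl fun i _ =>
      show (Finset.Icc (w i - n) (w i + n)).card = 2 * n + 1 by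
        rw [Int.card_Icc, show w i + (n : ℤ) + 1 - (w i - n) = ((2 * n + 1 : ℕ) : ℤ) by push_cast; ring, Int.toNat_natCast],
      Finset.prod_const, Finset.card_univ, Fintype.card_fin]
  calc ∑ X ∈ S, |Kfib (bmF r n) b β w X| ≤ ∑ _X ∈ S, 2 * (((d : ℝ) + 1) * n) :=
        Finset.sum_le_sum fun X _ => by rw [Kfib_apply]; exact abs_bmF_le r n hr w X β
    _ = ((2 * n + 1) ^ (d + 1) : ℕ) * (2 * (((d : ℝ) + 1) * n)) := by
        rw [Finset.sum_const, nsmul_eq_mul, hcard]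

/-- [folklore] The two-point row sum: `Σ'_w dzKer α x w · f w = f (x + e_α) − f x`. -/
theorem tsum_dzKer_mul (α : Fin (d + 1)) (x : Fin (d + 1) → ℤ) (f : (Fin (d + 1) → ℤ) → ℝ) :
    ∑' w, dzKer α x w * f w = f (x + unitVec α) - f x := by
  have e : (fun w => dzKer α x w * f w)
      = fun w => (if w = x + unitVec α then f w else 0) - (if w = x then f w else 0) := by
    funext w
    simp only [dzKer]
    split_ifs <;> ring
  rw [e, Summable.tsum_sub, tsum_eq_single (x + unitVec α) (fun w hw => if_neg hw), if_pos rfl, tsum_eq_single x (fun w hw => if_neg hw),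
    if_pos rfl]
  · exact summable_of_ne_finset_zero (s := {x + unitVec α}) fun w hw => by
      rw [Finset.mem_singleton] at hw; rw [if_neg hw]
  · exact summable_of_ne_finset_zero (s := {x}) fun w hw => by
      rw [Finset.mem_singleton] at hw; rw [if_neg hw]

/-- [folklore] **THE LATTICE IDENTITY `dzF ∘ bmF = δ − (Πᵀ)_ff`**: `grad λ_{(β,X)} = δ_{(β,X)} − Π_bm δ_{(β,X)}` (definition of `axProjBmAt`) and
`(Π_bm δ_{(β,X)})_α(x) = piKBm ρ n X x (inl β) (inl α)` (`piKBm_inl_inl_eq`, in-block root). -/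
theorem compF_dzF_bmF (hr : r ∈ box (d + 1) n) :
    compF (dzF (d := d)) (bmF r n) = kdeltaF - toF (PackedKernelSplit.blk (trK (piKBm (toSite r) n)) true true) := by
  funext ⟨x, α⟩ ⟨X, β⟩
  rw [Pi.sub_apply, Pi.sub_apply]
  simp only [compF, Finset.univ_unique, Finset.sum_singleton]
  show ∑' w, dzKer α x w * bmGaugeAt (toSite r) (delta1 β X) n w = _
  rw [tsum_dzKer_mul]
  show _ = kdeltaF (x, α) (X, β) - trK (piKBm (toSite r) n) x X (Sum.inl α) (Sum.inl β)
  rw [trK_apply, piKBm_inl_inl_eq (NeZero.one_le (n := n)) hr]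
  unfold axProjBmAt
  rw [Pi.sub_apply, Pi.sub_apply, delta1_apply, kdeltaF]
  simp only [grad, Prod.mk.injEq]
  by_cases h1 : x = X
  · by_cases h2 : α = β
    · simp [h1, h2]
    · simp [h2]
  · simp [h1]

/-! ## §3 `ĝrad · N̂F = 1 − ((Πᵀ)_ff)^` on the fine torus; `Π̂` re-indexed; `Ŵ₀ = ĝrad · N̂` -/

section Torus
variable {D : ℕ} {α β : Type*} {s : ℕ} [NeZero s]

/-- [folklore] Periodisation of a difference of fibrewise summable kernels. -/
theorem periodiseF_sub_matrix {K L : FKer D α β} (hK : ∀ a b x, Summable (Kfib K a b x)) (hL : ∀ a b x, Summable (Kfib L a b x)) :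
    Matrix.of (periodiseF s (K - L)) = Matrix.of (periodiseF s K) - Matrix.of (periodiseF s L) := by
  ext i j
  rw [Matrix.sub_apply, Matrix.of_apply, Matrix.of_apply, Matrix.of_apply, sub_eq_add_neg K L,
    show K + -L = K + fun i' j' => -L i' j' from rfl, periodiseF_add hK (fun a b x => (hL a b x).neg.congr fun y => rfl), periodiseF_neg', sub_eq_add_neg]

/-- [folklore] Fibres of the Kronecker kernel are summable (one point). -/
theorem summable_Kfib_kdeltaF [DecidableEq α] (a b : α) (x : Fin D → ℤ) : Summable (Kfib (kdeltaF (d := D)) a b x) :=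
  summable_of_ne_finset_zero (s := {x}) fun y hy => by
    rw [Finset.mem_singleton] at hy
    rw [Kfib_apply, kdeltaF, if_neg]
    exact fun h => hy (Prod.mk.inj h).1.symm

end Torus

/-- [folklore] Fibres of the ff block of `Π̂ᵀ` are summable (`spr_trK_piKBm`). -/
theorem summable_Kfib_blk_trK_piKBm (hr : r ∈ box (d + 1) n) (a b : Fin (d + 1)) (x : Fin (d + 1) → ℤ) :
    Summable (Kfib (toF (PackedKernelSplit.blk (trK (piKBm (toSite r) n)) true true)) a b x) := by
  obtain ⟨C, δ, hδ, hdec⟩ := spr_trK_piKBm (NeZero.one_le (n := n)) hr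
  exact (summable_abs_row hdec hδ x (Sum.inl a) (Sum.inl b)).of_abs

/-- [folklore] **`ĝrad · N̂F = 1 − ((Πᵀ)_ff)^` ON THE FINE TORUS** (`compF_dzF_bmF` periodised by the product rule `periodiseF_compF_matrix`). -/
theorem gradHat_mul_NhatF (hr : r ∈ box (d + 1) n) :
    gradHat (d := d) (n * p) * NhatF r n (n * p)
      = 1 - Matrix.of (periodiseF (n * p) (toF (PackedKernelSplit.blk (trK (piKBm (toSite r) n)) true true))) := by
  rw [gradHat_mul_NhatF_eq, ← periodiseF_compF_matrix (summable_abs_dzF) (isPeriodic₂_bmF r n p) (rowBound_bmF r n hr),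
    compF_dzF_bmF r n hr, periodiseF_sub_matrix (summable_Kfib_kdeltaF) (summable_Kfib_blk_trK_piKBm r n hr), periodiseF_kdeltaF_matrix]

/-- [folklore] The ff block of `Π̂ᵀ` is block covariant. -/
theorem shiftK_blk_trK_piKBm (t : Fin (d + 1) → ℤ) :
    shiftK ((n : ℤ) • t) (PackedKernelSplit.blk (trK (piKBm (toSite r) n)) true true) = PackedKernelSplit.blk (trK (piKBm (toSite r) n)) true true := by
  show PackedKernelSplit.blk (shiftK ((n : ℤ) • t) (trK (piKBm (toSite r) n))) true true = _
  rw [shiftK_trK_piKBm]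

/-- [folklore] **PART 1's `Π̂` IS THE FINE-TORUS `((Πᵀ)_ff)^` RE-INDEXED BY `e₁`** (`SortedEmbedding.periodiseF_reblock_eq_submatrix`). -/
theorem PiHat_eq_submatrix (hr : r ∈ box (d + 1) n) :
    PiHat r n p = (Matrix.of (periodiseF (n * p) (toF (PackedKernelSplit.blk (trK (piKBm (toSite r) n)) true true)))).submatrix
      (e₁ n p) (e₁ n p) := by
  rw [PiHat, fTL_sortK]
  exact periodiseF_reblock_eq_submatrix (fun a b => isPeriodic₂_of_blockCov (shiftK_blk_trK_piKBm r n) p a b)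
    (fun a b x => summable_Kfib_blk_trK_piKBm r n hr a b x)

/-- [folklore] **`1 − Π̂ = (ĝrad · N̂F) re-indexed by `e₁`.** -/
theorem one_sub_PiHat_eq (hr : r ∈ box (d + 1) n) :
    1 - PiHat r n p = (gradHat (d := d) (n * p) * NhatF r n (n * p)).submatrix (e₁ n p) (e₁ n p) := by
  rw [gradHat_mul_NhatF r n p hr, Matrix.submatrix_sub, Pi.sub_apply, Pi.sub_apply, Matrix.submatrix_one_equiv, PiHat_eq_submatrix r n p hr]

/-- [folklore] Right multiplication by `τ_Tᵀ` picks the comb columns. -/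
theorem mul_tauT_transpose_apply (M : Matrix (I d n p) (I d n p) ℝ) (i : I d n p) (b : CombRows (toSite r) n p) :
    (M * (tauT (toSite r) n p)ᵀ) i b = M i b.1 := by
  rw [Matrix.mul_apply]
  simp only [Matrix.transpose_apply, tauT_apply, mul_ite, mul_one, mul_zero, Finset.sum_ite_eq', Finset.mem_univ, if_true]

/-- [folklore] **`Ŵ₀ = ĝrad · N̂`**: the gauge-basis matrix of PART 1 is the fine-torus gradient of the basis matrix `N̂` (rows re-indexed to the
sorted currency by `e₁`; in-block root). -/
theorem What0_eq_grad_Nhat (hr : r ∈ box (d + 1) n) :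
    What0 r n p = (gradHat (d := d) (n * p)).submatrix (e₁ n p) id * Nhat r n p := by
  ext i b
  rw [What0, mul_tauT_transpose_apply, one_sub_PiHat_eq r n p hr, Matrix.submatrix_apply, Matrix.mul_apply, Matrix.mul_apply]
  rfl

end Summit.QuantumFields.BalabanUV.Beta.D1BFx.TorusGaugeBasisMatrix

end
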